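import Summits.AtomisticToContinuum.HydrodynamicLimit.Theorems.AntiMazurCoboundariesCorrectorPressureDecayKiferCellTranslation
import Summits.AtomisticToContinuum.HydrodynamicLimit.Theorems.AntiMazurCoboundariesCorrectorPressureDecayKiferCanonicalBlowUpDominationCore
import Literature.MathematicalPhysics.StatisticalMechanics.DiluteHardSphereGasProofs
import Literature.Analysis.FunctionSpaces.PoissonRestrictionIndependence
import Mathlib.Probability.ConditionalProbability

/-!
# Tools for the cell-tuple law of the blown-up canonical torus law: conditioning, Poisson laws, cells, the canonical law
# as a conditioned ideal gas (line `FirstLemma`, crux stmt-AtomisticToContinuum-14135)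

Helper file (Core; no new definitions) of the registered stub `c9_map_cellTuple_canonicalBlowUp_eq_cond` (lead seat c9,
Gibbs route of the uniform entropy bound; file `…KiferCanonicalCellTuple.lean`), namespace
`Summit.AtomisticToContinuum.HydrodynamicLimit.Theorems.KiferCompactification`. The cells `c9Cell S m j` of the cube
`(-S/2, S/2]³` are those of `…KiferCellTranslation.lean`.

* Conditioning (`ProbabilityTheory.cond`): push-forward along preimages (`cond_map_eq_map_cond`), invariance under null
  modifications of the event (`cond_congr_ae`) and under nonzero finite scalars (`cond_smul_measure`), conditioning on an
  intersection (`cond_inter_eq_cond_restrict`), and **products of conditioned measures** (`pi_cond_eq_cond_pi`).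
* Poisson laws (`HardSphere.poissonLaw`) from the tree's Kingman theory: the restriction theorem in law
  (`poissonLaw_map_restrict`, restriction + Rényi uniqueness), **complete independence over disjoint windows in law**
  (`map_pi_restrict_eq_pi_of_poisson`, from `IsPoissonPointProcess.iIndepFun_restrict`), the binomial layer
  (`restrict_count_eq_smul_map_ofFn_of_poisson`, the Janossy formula `measure_inter_count_univ_eq` as a measure identity),
  and **the free finite-volume hard-sphere measure is the Poisson law conditioned on the hard core**
  (`gibbsSpecMeasure_empty_eq_cond_poissonLaw`, the tree's bridge `hsLocalSpec_eq_gibbsSpec`).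
* Cells: measurable (`measurableSet_c9Cell`), pairwise disjoint (`c9Cell_eq_of_mem`), covering the cube
  (`exists_mem_c9Cell`; `smul_symCube_eq_iUnion_c9Cell`: `ε⁻¹ · (-1/2, 1/2]³ = ⋃ cells`), bounded
  (`isBounded_iUnion_c9Cell`); the cell counts of a covered configuration add up (`sum_count_restrict_window_c9Cell`);
  a `k`-tuple whose configuration has `k` points is injective (`injective_of_count_ofFn_eq`); cross hard-core events
  `{∀ p ∈ g₁, ∀ q ∈ g₂, (p, q) ∉ B}` are measurable (`measurableSet_forall_mem_notMem`, a Campbell sum of void events over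
  the tree's counting kernel).
* Torus geometry: a coordinate circle distance is `min |r| (1 - |r|)` for the difference `r ∈ (-1, 1)` of symmetric
  representatives around a base point (`norm_apply_sub_eq_min`); **the constant-profile canonical law is the ideal gas
  `(Haar ⊗ N(u₀,θ))^{⊗(N+1)}` conditioned on the torus hard core** (`localGibbsLaw_const_eq_cond`, from the rung-0 product
  structure `localGibbsMeasure_rung0_eq_map`); **the blow-up of one ideal-gas particle has law `ε³ · (Leb_C ⊗ M)`**,
  `C = ε⁻¹ · (-1/2, 1/2]³` (`map_blowUpPoint_eq`, the exact form of `map_blowUpPoint_le`).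

References: J. F. C. Kingman, *Poisson Processes* (1993) §2.2–2.5; G. Last, M. Penrose, *Lectures on the Poisson Process*
(2017) Prop. 2.7, Prop. 3.5; D. Ruelle, *Statistical Mechanics: Rigorous Results* (1969) §1.2.1; H. Spohn, *Large Scale
Dynamics of Interacting Particles* (1991) Part I §2.3.
-/

noncomputable section

open MeasureTheory ProbabilityTheory Set Filter Topology Function
open scoped ENNReal NNReal Pointwise

namespace Summit.AtomisticToContinuum.HydrodynamicLimit.Theorems.KiferCompactification

open Literature.MathematicalPhysics.KineticTheory (T3 V3 hsDiameter localGibbsLaw blowUpPoint gaussMeasure hsLocalSpec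
  hsLocalSpec_def glue_empty isProbabilityMeasure_localGibbsLaw localGibbsLaw_eq localGibbsMeasure_rung0_eq_map
  posGibbsMeasure_const_eq_one posGibbsMeasure_eq Xi firstLabels_self profileOf_one_μ zipConfig Ov)
open Literature.MathematicalPhysics.KineticTheory.HardSphereDLR (gibbsSpecMeasure gibbsSpecMeasure_apply)
open Literature.MathematicalPhysics.StatisticalMechanics (hsLocalSpec_eq_gibbsSpec restrict_window_smul_prod
  smul_prod_singleton withDensity_maxwellianBeta_eq_map_stdGaussian hcProb)
open Literature.MathematicalPhysics.StatisticalMechanics.HardSphere (window measurableSet_window mem_window poissonLaw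
  isPoissonPointProcess_poissonLaw hardCoreSet isHardCore_empty glue)
open Literature.Analysis.FluidPDE (HardSphereFlow Config)
open Literature.Analysis.FunctionSpaces (PointConfig IsPoissonPointProcess)
open Literature.Analysis.FluidPDE.Torus (reprSym symCube measurable_reprSym map_reprSym_volume)

/-! ## Conditioning: elementary rules -/

/-- Conditioning commutes with push-forward along preimages: `(f_* μ)[|E] = f_* (μ[|f⁻¹ E])`. -/
theorem cond_map_eq_map_cond {α β : Type*} [MeasurableSpace α] [MeasurableSpace β] {f : α → β} (hf : Measurable f)
    (μ : Measure α) {E : Set β} (hE : MeasurableSet E) : (μ.map f)[|E] = (μ[|f ⁻¹' E]).map f := by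
  rw [ProbabilityTheory.cond, ProbabilityTheory.cond, Measure.map_smul, Measure.map_apply hf hE, Measure.restrict_map hf hE]

/-- Conditioning only sees the event up to null sets. -/
theorem cond_congr_ae {α : Type*} [MeasurableSpace α] (μ : Measure α) {s t : Set α} (h : s =ᵐ[μ] t) :
    μ[|s] = μ[|t] := by
  rw [ProbabilityTheory.cond, ProbabilityTheory.cond, measure_congr h, Measure.restrict_congr_set h]

/-- Nonzero finite scalars drop out of conditioning. -/
theorem cond_smul_measure {α : Type*} [MeasurableSpace α] (μ : Measure α) {c : ℝ≥0∞} (h0 : c ≠ 0) (htop : c ≠ ∞)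
    (s : Set α) : (c • μ)[|s] = μ[|s] := by
  rw [ProbabilityTheory.cond, ProbabilityTheory.cond, Measure.smul_apply, smul_eq_mul, Measure.restrict_smul, smul_smul,
    ENNReal.mul_inv (Or.inl h0) (Or.inl htop), mul_assoc, mul_comm (μ s)⁻¹, ← mul_assoc, ENNReal.inv_mul_cancel h0 htop,
    one_mul]

/-- Conditioning on an intersection is conditioning the restriction. -/
theorem cond_inter_eq_cond_restrict {α : Type*} [MeasurableSpace α] (μ : Measure α) {s t : Set α}
    (hs : MeasurableSet s) : μ[|s ∩ t] = (μ.restrict t)[|s] := by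
  rw [ProbabilityTheory.cond, ProbabilityTheory.cond, Measure.restrict_apply hs, Measure.restrict_restrict hs]

/-- **A product of conditioned finite measures is the product measure conditioned on the rectangle.** -/
theorem pi_cond_eq_cond_pi {ι : Type*} [Fintype ι] {α : ι → Type*} [∀ i, MeasurableSpace (α i)]
    (μ : ∀ i, Measure (α i)) [∀ i, IsFiniteMeasure (μ i)] {H : ∀ i, Set (α i)} (hH : ∀ i, MeasurableSet (H i)) :
    Measure.pi (fun i => (μ i)[|H i]) = (Measure.pi μ)[|Set.pi univ H] := by
  refine Measure.pi_eq fun s hs => ?_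
  rw [cond_apply (MeasurableSet.univ_pi hH), ← Set.pi_inter_distrib, Measure.pi_pi, Measure.pi_pi,
    ENNReal.prod_inv_distrib (fun i _ j _ _ => Or.inr (measure_ne_top _ _)), ← Finset.prod_mul_distrib]
  exact Finset.prod_congr rfl fun i _ => (cond_apply (hH i) _ _).symm

/-! ## Poisson laws: restriction, independence over disjoint windows, the binomial layer -/

/-- **Restriction Theorem in law**: the restriction to a measurable `W` of the Poisson law of intensity `ν` is the Poisson
law of intensity `ν|_W` (Kingman's restriction theorem and Rényi's uniqueness, both proved in the tree). -/
theorem poissonLaw_map_restrict (ν : Measure (V3 × V3)) [IsLocallyFiniteMeasure ν] (h0 : ∀ x, ν {x} = 0)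
    {W : Set (V3 × V3)} (hW : MeasurableSet W) :
    (poissonLaw ν).map (PointConfig.restrict W) = poissonLaw (ν.restrict W) :=
  IsPoissonPointProcess.unique_holds (IsPoissonPointProcess.restrict_holds (isPoissonPointProcess_poissonLaw ν h0) hW)
    (isPoissonPointProcess_poissonLaw _ fun x => nonpos_iff_eq_zero.mp ((Measure.restrict_apply_le _ _).trans_eq (h0 x)))

/-- **Complete independence of a Poisson process over disjoint windows, in law**: the joint law of the restrictions to
finitely many pairwise disjoint measurable sets is the product of their laws. -/
theorem map_pi_restrict_eq_pi_of_poisson {J : Type*} [Fintype J] {ν : Measure (V3 × V3)}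
    {P : Measure (PointConfig (V3 × V3))} (hP : IsPoissonPointProcess ν P) {W : J → Set (V3 × V3)}
    (hW : ∀ j, MeasurableSet (W j)) (hd : Pairwise (Disjoint on W)) :
    P.map (fun c j => c.restrict (W j)) = Measure.pi fun j => P.map (PointConfig.restrict (W j)) := by
  haveI := hP.isProbabilityMeasure
  set e := Fintype.equivFin J
  have hind : iIndepFun (fun i => PointConfig.restrict (W (e.symm i))) P :=
    hP.iIndepFun_restrict (fun i => hW _) fun i i' hii' => hd (e.symm.injective.ne hii')
  have hind' : iIndepFun (fun j => PointConfig.restrict (W j)) P := by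
    have h := hind.precomp e.injective
    simp only [Equiv.symm_apply_apply] at h
    exact h
  exact hind'.map_fun_eq_pi_map fun j => (PointConfig.measurable_restrict (hW j)).aemeasurable

/-- **The binomial layer of a finite Poisson process**: restricted to `{N = k}`, the Poisson law of a finite atomless
intensity `ν` is `e^{-ν(E)} (k!)⁻¹` times the law of `{x₁,…,x_k}` for a `ν^{⊗k}`-distributed tuple (the Janossy formula on
the layer, `measure_inter_count_univ_eq`). -/
theorem restrict_count_eq_smul_map_ofFn_of_poisson {ν : Measure (V3 × V3)} [IsFiniteMeasure ν]
    {P : Measure (PointConfig (V3 × V3))} (hP : IsPoissonPointProcess ν P) (h0 : ∀ x, ν {x} = 0) (k : ℕ) :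
    P.restrict {c | c.count univ = k} = (ENNReal.ofReal (Real.exp (-(ν univ).toReal)) * ((k.factorial : ℝ≥0∞))⁻¹) •
      (Measure.pi fun _ : Fin k => ν).map PointConfig.ofFn := by
  ext B hB
  rw [Measure.restrict_apply hB, hP.measure_inter_count_univ_eq h0 hB k, Measure.smul_apply, smul_eq_mul,
    Measure.map_apply (PointConfig.measurable_ofFn k) hB,
    ← lintegral_indicator_one (hB.preimage (PointConfig.measurable_ofFn k)), mul_assoc]
  rfl

/-! ## The free cell measure is a conditioned Poisson law -/

/-- **The free finite-volume hard-sphere measure is the Poisson law conditioned on the hard core**: for `z, θ > 0` and a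
bounded measurable window `Λ`, `γ_Λ(· | ∅) = (Poisson law of intensity z · Leb_Λ ⊗ N(u₀, θ))[| unit hard core]` (the
tree's bridge `hsLocalSpec_eq_gibbsSpec` between the series form and the Poisson form of the specification, the empty
boundary condition gluing to a restriction, and Kingman's restriction theorem). -/
theorem gibbsSpecMeasure_empty_eq_cond_poissonLaw {z θ : ℝ} (hz : 0 < z) (hθ : 0 < θ) (u₀ : V3) {Λ : Set V3}
    (hΛ : MeasurableSet Λ) (hΛb : Bornology.IsBounded Λ) :
    gibbsSpecMeasure 1 z θ⁻¹ u₀ Λ ∅ =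
      (poissonLaw ((Real.toNNReal z) • (((volume : Measure V3).restrict Λ).prod (gaussMeasure u₀ θ))))[|hardCoreSet 1] := by
  have hM : ((volume : Measure V3).withDensity fun v => ENNReal.ofReal
      (Literature.Analysis.FunctionSpaces.maxwellianBeta θ⁻¹ (v - u₀))) = gaussMeasure u₀ θ := by
    rw [withDensity_maxwellianBeta_eq_map_stdGaussian (inv_pos.2 hθ) u₀, inv_inv]
    rfl
  set ν : Measure (V3 × V3) := (Real.toNNReal z) • ((volume : Measure V3).prod (gaussMeasure u₀ θ)) with hν
  have h1 : gibbsSpecMeasure 1 z θ⁻¹ u₀ Λ ∅ = hsLocalSpec 1 ν Λ ∅ := by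
    ext A hA
    rw [gibbsSpecMeasure_apply 1 z θ⁻¹ u₀ hΛ ∅ hA, hν, ← hM,
      hsLocalSpec_eq_gibbsSpec u₀ hz.le (inv_pos.2 hθ) hΛ hΛb (isHardCore_empty 1) hA]
  have h0 : ∀ x, ν.restrict (window Λ) {x} = 0 := fun x =>
    nonpos_iff_eq_zero.mp ((Measure.restrict_apply_le _ _).trans_eq (smul_prod_singleton z _ x))
  have hglue : glue Λ ∅ = PointConfig.restrict (window Λ) := funext (glue_empty Λ)
  rw [h1, hsLocalSpec_def, hglue, poissonLaw_map_restrict _ h0 (measurableSet_window hΛ),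
    Measure.restrict_restrict (measurableSet_window hΛ), Set.inter_self, Measure.restrict_apply_univ, hν,
    restrict_window_smul_prod]
  rfl

/-! ## Cells: measurability, disjointness, covering -/

variable {S : ℝ} {m : ℕ}

/-- The cells are measurable. -/
theorem measurableSet_c9Cell (S : ℝ) (m : ℕ) (j : Fin 3 → Fin m) : MeasurableSet (c9Cell S m j) := by
  have h : c9Cell S m j = ⋂ i, (fun y : V3 => y i) ⁻¹'
      Ioc (-S / 2 + ((j i : ℕ) : ℝ) * (S / m)) (-S / 2 + (((j i : ℕ) : ℝ) + 1) * (S / m)) := by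
    ext y; simp [c9Cell]
  rw [h]
  exact MeasurableSet.iInter fun i => measurableSet_Ioc.preimage (by fun_prop)

/-- The cells are pairwise disjoint: two cells sharing a point coincide. -/
theorem c9Cell_eq_of_mem (hS : 0 < S) (hm : 0 < m) {j j' : Fin 3 → Fin m} {y : V3} (hy : y ∈ c9Cell S m j)
    (hy' : y ∈ c9Cell S m j') : j = j' := by
  have hu : 0 < S / m := div_pos hS (Nat.cast_pos.2 hm)
  have key : ∀ {a b : ℕ} {t : ℝ}, -S / 2 + (a : ℝ) * (S / m) < t → t ≤ -S / 2 + ((b : ℝ) + 1) * (S / m) → a ≤ b := by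
    intro a b t ha hb
    have h3 : (a : ℝ) < b + 1 := lt_of_mul_lt_mul_right (by linarith) hu.le
    exact Nat.lt_succ_iff.1 (by exact_mod_cast h3)
  funext i
  exact Fin.ext (le_antisymm (key (hy i).1 (hy' i).2) (key (hy' i).1 (hy i).2))

/-- The cells cover the cube `(-S/2, S/2]³`. -/
theorem exists_mem_c9Cell (hS : 0 < S) (hm : 0 < m) {y : V3} (hy : ∀ i, y i ∈ Ioc (-S / 2) (S / 2)) :
    ∃ j, y ∈ c9Cell S m j := by
  have hm0 : (0 : ℝ) < m := Nat.cast_pos.2 hm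
  have hu : 0 < S / m := div_pos hS hm0
  have hk : ∀ i, ∃ k : Fin m, ((k : ℕ) : ℝ) * (S / m) < y i + S / 2 ∧ y i + S / 2 ≤ (((k : ℕ) : ℝ) + 1) * (S / m) := by
    intro i
    obtain ⟨h1, h2⟩ := hy i
    set t := (y i + S / 2) / (S / m) with ht
    have ht0 : 0 < t := div_pos (by linarith) hu
    have htm : t ≤ m := by rw [ht, div_le_iff₀ hu, mul_div_cancel₀ _ hm0.ne']; linarith
    have hc0 : 0 < ⌈t⌉₊ := Nat.ceil_pos.2 ht0
    refine ⟨⟨⌈t⌉₊ - 1, by have := Nat.ceil_le.2 htm; omega⟩, ?_, ?_⟩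
    · have h : ((⌈t⌉₊ - 1 : ℕ) : ℝ) < t := by
        rw [Nat.cast_sub hc0, Nat.cast_one]; linarith [Nat.ceil_lt_add_one ht0.le]
      rwa [ht, lt_div_iff₀ hu] at h
    · have h : t ≤ ((⌈t⌉₊ - 1 : ℕ) : ℝ) + 1 := by
        rw [Nat.cast_sub hc0, Nat.cast_one, sub_add_cancel]; exact Nat.le_ceil t
      rwa [ht, div_le_iff₀ hu] at h
  choose k hk using hk
  exact ⟨k, fun i => ⟨by linarith [(hk i).1], by linarith [(hk i).2]⟩⟩

/-- The blown-up torus cube `ε⁻¹ · (-1/2, 1/2]³` is the union of the cells. -/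
theorem smul_symCube_eq_iUnion_c9Cell {ε : ℝ} (hε : 0 < ε) (hm : 0 < m) :
    ε⁻¹ • symCube (Fin 3) = ⋃ j, c9Cell ε⁻¹ m j := by
  ext y
  rw [Set.mem_smul_set_iff_inv_smul_mem₀ (inv_ne_zero hε.ne'), inv_inv, mem_iUnion]
  simp only [symCube, mem_setOf_eq, PiLp.smul_apply, smul_eq_mul]
  refine ⟨fun h => exists_mem_c9Cell (inv_pos.2 hε) hm fun i => ⟨?_, ?_⟩,
    fun ⟨j, hj⟩ i => mul_apply_mem_Ioc_of_mem_c9Cell hε hm hj i⟩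
  · exact lt_of_mul_lt_mul_left (by rw [show ε * (-ε⁻¹ / 2) = -(1 / 2) by field_simp]; exact (h i).1) hε.le
  · exact le_of_mul_le_mul_left (by rw [show ε * (ε⁻¹ / 2) = 1 / 2 by field_simp]; exact (h i).2) hε

/-- The union of the cells is bounded. -/
theorem isBounded_iUnion_c9Cell {ε : ℝ} (hε : 0 < ε) (hm : 0 < m) : Bornology.IsBounded (⋃ j, c9Cell ε⁻¹ m j) := by
  rw [← smul_symCube_eq_iUnion_c9Cell hε hm]
  refine ((isBounded_centredBox 0).subset fun y hy i => ?_).smul₀ ε⁻¹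
  have h := hy i
  simp only [Nat.cast_zero, zero_add, mem_Ico]
  exact ⟨by linarith [h.1], by linarith [h.2]⟩

/-! ## Counting through the cells; cross hard-core events -/

/-- **The cell counts add up**: for a configuration whose positions are covered by the cells, the total number of points
of its cell restrictions is its number of points (the cells are pairwise disjoint). -/
theorem sum_count_restrict_window_c9Cell (hS : 0 < S) (hm : 0 < m) {ω : PointConfig (V3 × V3)}
    (hcov : ∀ p ∈ ω, ∃ j, p.1 ∈ c9Cell S m j) :
    (∑ j, (ω.restrict (window (c9Cell S m j))).count univ) = ω.count univ := by
  have hdisj : Pairwise (Disjoint on fun j : Fin 3 → Fin m => ω.carrier ∩ window (c9Cell S m j)) := fun j j' hjj' =>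
    Set.disjoint_left.2 fun p hp hp' => hjj' (c9Cell_eq_of_mem hS hm (mem_window.1 hp.2) (mem_window.1 hp'.2))
  simp only [PointConfig.count_restrict, Set.inter_univ]
  simp only [PointConfig.count, Set.inter_univ]
  rw [← finsum_eq_sum_of_fintype, ← Set.encard_iUnion_of_finite hdisj, ← Set.inter_iUnion,
    Set.inter_eq_left.2 fun p hp => ?_]
  obtain ⟨j, hj⟩ := hcov p hp
  exact Set.mem_iUnion.2 ⟨j, mem_window.2 hj⟩

/-- A `k`-tuple whose configuration has `k` points is injective. -/
theorem injective_of_count_ofFn_eq {k : ℕ} {y : Fin k → V3 × V3} (h : (PointConfig.ofFn y).count univ = k) :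
    Injective y := by
  classical
  have h1 : (PointConfig.ofFn y).count univ = ((Finset.univ.image y).card : ℕ∞) := by
    rw [PointConfig.count, Set.inter_univ, PointConfig.carrier_ofFn, ← Set.image_univ, ← Finset.coe_univ,
      ← Finset.coe_image, Set.encard_coe_eq_coe_finsetCard]
  rw [h1, Nat.cast_inj] at h
  have h2 : Set.InjOn y ↑(Finset.univ : Finset (Fin k)) :=
    Finset.card_image_iff.1 (by rw [h, Finset.card_univ, Fintype.card_fin])
  exact fun a b hab => h2 (Finset.mem_coe.2 (Finset.mem_univ a)) (Finset.mem_coe.2 (Finset.mem_univ b)) hab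

/-- **Cross hard-core events are measurable**: for measurable configuration-valued maps `g₁, g₂` and a measurable set
`B` of "bad" pairs, `{a | ∀ p q, p ∈ g₁ a → q ∈ g₂ a → (p, q) ∉ B}` is measurable (a Campbell sum of void events,
`PointConfig.measurable_tsum_carrier` and `PointConfig.measurable_toMeasure_preimage`). -/
theorem measurableSet_forall_mem_notMem {α : Type*} [MeasurableSpace α] {g₁ g₂ : α → PointConfig (V3 × V3)}
    (hg₁ : Measurable g₁) (hg₂ : Measurable g₂) {B : Set ((V3 × V3) × (V3 × V3))} (hB : MeasurableSet B) :
    MeasurableSet {a | ∀ p q, p ∈ g₁ a → q ∈ g₂ a → (p, q) ∉ B} := by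
  set t : Set ((α × (V3 × V3)) × (V3 × V3)) := {r | (r.1.2, r.2) ∈ B} with ht
  have htm : MeasurableSet t := hB.preimage (measurable_fst.snd.prodMk measurable_snd)
  have hF : Measurable fun ap : α × (V3 × V3) => (g₂ ap.1).toMeasure (Prod.mk ap ⁻¹' t) :=
    PointConfig.measurable_toMeasure_preimage htm (hg₂.comp measurable_fst)
  have hS := PointConfig.measurable_tsum_carrier hF hg₁
  have hset : {a | ∀ p q, p ∈ g₁ a → q ∈ g₂ a → (p, q) ∉ B} = (fun a => ∑' p : ((g₁ a : PointConfig (V3 × V3)) :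
      Set (V3 × V3)), (g₂ a).toMeasure (Prod.mk (a, (p : V3 × V3)) ⁻¹' t)) ⁻¹' {0} := by
    ext a
    simp only [mem_setOf_eq, mem_preimage, mem_singleton_iff, ENNReal.tsum_eq_zero, Subtype.forall]
    refine ⟨fun h p hp => ?_, fun h p q hp hq hB' => ?_⟩
    · rw [PointConfig.toMeasure_apply _ (measurable_prodMk_left htm), ENat.toENNReal_eq_zero, PointConfig.count,
        Set.encard_eq_zero, Set.eq_empty_iff_forall_notMem]
      exact fun q hq => h p q hp hq.1 hq.2
    · have h0 := h p hp
      rw [PointConfig.toMeasure_apply _ (measurable_prodMk_left htm), ENat.toENNReal_eq_zero, PointConfig.count,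
        Set.encard_eq_zero, Set.eq_empty_iff_forall_notMem] at h0
      exact h0 q ⟨hq, hB'⟩
  rw [hset]
  exact hS (measurableSet_singleton 0)

/-! ## Torus geometry: coordinate distances, the canonical law as a conditioned ideal gas, the exact blow-up -/

/-- For `|r| < 1`: `min (fract r) (1 - fract r) = min |r| (1 - |r|)`. -/
theorem min_fract_eq_min_abs {r : ℝ} (hr : |r| < 1) : min (Int.fract r) (1 - Int.fract r) = min |r| (1 - |r|) := by
  rcases le_or_gt 0 r with h | h
  · have hr1 : r < 1 := by rwa [abs_of_nonneg h] at hr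
    rw [Int.fract_eq_self.2 ⟨h, hr1⟩, abs_of_nonneg h]
  · have hr1 : -1 < r := by rw [abs_of_neg h] at hr; linarith
    have hf : Int.fract r = r + 1 := by
      rw [Int.fract, show ⌊r⌋ = -1 from Int.floor_eq_iff.2 ⟨by push_cast; linarith, by push_cast; linarith⟩]
      push_cast; ring
    rw [hf, abs_of_neg h, min_comm]
    congr 1 <;> ring

/-- **A coordinate circle distance through representatives around a base point**: `‖aₖ - bₖ‖ = min |r| (1 - |r|)` with
`r = reprSym (a - x₀) k - reprSym (b - x₀) k ∈ (-1, 1)`. -/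
theorem norm_apply_sub_eq_min (a b x₀ : T3) (k : Fin 3) :
    ‖a k - b k‖ = min |reprSym (a - x₀) k - reprSym (b - x₀) k| (1 - |reprSym (a - x₀) k - reprSym (b - x₀) k|) := by
  set r : ℝ := reprSym (a - x₀) k - reprSym (b - x₀) k with hr
  have hcoe : ((r : ℝ) : UnitAddCircle) = a k - b k := by
    rw [hr, AddCircle.coe_sub, Literature.Analysis.FluidPDE.Torus.reprSym_apply,
      Literature.Analysis.FluidPDE.Torus.reprSym_apply, AddCircle.coe_equivIoc, AddCircle.coe_equivIoc, Pi.sub_apply,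
      Pi.sub_apply, sub_sub_sub_cancel_right]
  have hlt : |r| < 1 := by
    have h1 := Literature.Analysis.FluidPDE.Torus.reprSym_apply_mem_Ioc (a - x₀) k
    have h2 := Literature.Analysis.FluidPDE.Torus.reprSym_apply_mem_Ioc (b - x₀) k
    rw [abs_lt]; constructor <;> linarith [h1.1, h1.2, h2.1, h2.2]
  rw [← hcoe, UnitAddCircle.norm_eq, abs_sub_round_eq_min, min_fract_eq_min_abs hlt]

/-- **The constant-profile canonical law is the ideal gas conditioned on the torus hard core**: for `σ ≤ 1/2`, `a, θ > 0`,
`localGibbsLaw σ a u₀ θ N Φ = ((Haar ⊗ N(u₀, θ))^{⊗(N+1)})[| no two positions at torus distance < ε_N]` (the rung-0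
product structure `localGibbsMeasure_rung0_eq_map` and `posGibbsMeasure_eq`; the activity drops out, and the law being a
probability measure (`σ ≤ 1/2`) the normalisation is the hard-core probability). -/
theorem localGibbsLaw_const_eq_cond {σ a θ : ℝ} (hσ2 : σ ≤ 1 / 2) (ha : 0 < a) (hθ : 0 < θ) (u₀ : V3) (N : ℕ)
    (Φ : HardSphereFlow (Literature.Analysis.FluidPDE.Torus.geometry (Fin 3)) (hsDiameter σ N) (N + 1)) :
    localGibbsLaw σ (fun _ => a) (fun _ => u₀) (fun _ => θ) N Φ =
      (Measure.pi fun _ : Fin (N + 1) => (volume : Measure T3).prod (gaussMeasure u₀ θ))[|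
        {z | (fun i => (z i).1) ∈ Literature.MathematicalPhysics.StatisticalMechanics.hardCoreSet (Ov (hsDiameter σ N))
          (Finset.univ : Finset (Fin (N + 1)))}] := by
  classical
  set Γ : Measure (Fin (N + 1) → V3) := Measure.pi fun _ => gaussMeasure u₀ θ with hΓ
  set Pq : Measure (Fin (N + 1) → T3) := Measure.pi fun _ => (volume : Measure T3) with hPq
  set HC : Set (Fin (N + 1) → T3) := Literature.MathematicalPhysics.StatisticalMechanics.hardCoreSet
    (Ov (hsDiameter σ N)) (Finset.univ : Finset (Fin (N + 1))) with hHC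
  set Z : ℝ := hcProb (Ov (hsDiameter σ N)) (volume : Measure T3) (Finset.univ : Finset (Fin (N + 1))) with hZ
  haveI : IsProbabilityMeasure (volume : Measure T3) := by rw [volume_pi]; infer_instance
  haveI := isProbabilityMeasure_localGibbsLaw (a₀ := fun _ => a) (θ₀ := fun _ => θ) (u₀ := fun _ => u₀)
    continuous_const continuous_const continuous_const (fun _ => ha) (fun _ => hθ) hσ2 N Φ
  have hlaw : localGibbsLaw σ (fun _ => a) (fun _ => u₀) (fun _ => θ) N Φ =
      ((ENNReal.ofReal Z⁻¹ • Pq.restrict HC).prod Γ).map zipConfig := by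
    rw [localGibbsLaw_eq, localGibbsMeasure_rung0_eq_map σ ha.le hθ u₀ N, posGibbsMeasure_const_eq_one ha,
      posGibbsMeasure_eq continuous_const (fun _ => one_pos), Xi, firstLabels_self, profileOf_one_μ]
  set e := (MeasurableEquiv.arrowProdEquivProdArrow T3 V3 (Fin (N + 1))).symm with he
  have hzip : (Pq.prod Γ).map e = Measure.pi fun _ : Fin (N + 1) => (volume : Measure T3).prod (gaussMeasure u₀ θ) :=
    ((measurePreserving_arrowProdEquivProdArrow T3 V3 (Fin (N + 1)) (fun _ => (volume : Measure T3))
      (fun _ => gaussMeasure u₀ θ)).symm _).map_eq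
  have hpre : e ⁻¹' {z | (fun i => (z i).1) ∈ HC} = HC ×ˢ univ := by
    ext p
    simp only [mem_preimage, mem_setOf_eq, mem_prod, mem_univ, and_true]
    exact Iff.rfl
  have h0 : Pq HC ≠ 0 := fun h0 => by
    have h := measure_univ (μ := localGibbsLaw σ (fun _ => a) (fun _ => u₀) (fun _ => θ) N Φ)
    rw [hlaw, Measure.restrict_eq_zero.2 h0, smul_zero, Measure.zero_prod, Measure.map_zero] at h
    exact zero_ne_one h
  rw [hlaw, show (zipConfig : (Fin (N + 1) → T3) × (Fin (N + 1) → V3) → Config (N + 1) (Fin 3) T3) = e from rfl,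
    ProbabilityTheory.cond, ← hzip, MeasurableEquiv.restrict_map, e.map_apply, hpre, ← Measure.restrict_prod_eq_prod_univ,
    Measure.prod_prod, measure_univ, mul_one, Measure.prod_smul_left, Measure.map_smul,
    show Z = (Pq HC).toReal from rfl, ← ENNReal.toReal_inv, ENNReal.ofReal_toReal (ENNReal.inv_ne_top.2 h0)]

/-- **Blow-up of one ideal-gas particle, exactly**: the law of `blowUpPoint ε x₀ (q, v)` under `Haar ⊗ M` is
`ε³ · (Leb|_C ⊗ M)` with `C = ε⁻¹ · (-1/2, 1/2]³` (Haar measure is translation invariant, `reprSym` pushes it to Lebesgue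
measure on the symmetric unit cube, and `y ↦ ε⁻¹ y` scales Lebesgue measure by `ε³`). -/
theorem map_blowUpPoint_eq {ε : ℝ} (hε : 0 < ε) (x₀ : T3) (M : Measure V3) [SFinite M] :
    ((volume : Measure T3).prod M).map (blowUpPoint ε x₀) =
      ENNReal.ofReal (ε ^ 3) • (((volume : Measure V3).restrict (ε⁻¹ • symCube (Fin 3))).prod M) := by
  have h1 : blowUpPoint ε x₀ = Prod.map (fun q : T3 => ε⁻¹ • reprSym (q - x₀)) id := funext fun p => rfl
  have hg : Measurable fun q : T3 => ε⁻¹ • reprSym (q - x₀) :=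
    (measurable_const_smul ε⁻¹).comp (measurable_reprSym.comp (measurable_sub_const x₀))
  have hs : MeasurableEmbedding fun y : V3 => ε⁻¹ • y :=
    (MeasurableEquiv.smul₀ ε⁻¹ (inv_ne_zero hε.ne')).measurableEmbedding
  have hpos : (volume : Measure T3).map (fun q => ε⁻¹ • reprSym (q - x₀)) =
      ENNReal.ofReal (ε ^ 3) • (volume : Measure V3).restrict (ε⁻¹ • symCube (Fin 3)) := by
    have hc : (fun q : T3 => ε⁻¹ • reprSym (q - x₀)) = (fun y : V3 => ε⁻¹ • y) ∘ reprSym ∘ fun q : T3 => q - x₀ := rfl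
    rw [hc, ← Measure.map_map (measurable_const_smul ε⁻¹) (measurable_reprSym.comp (measurable_sub_const x₀)),
      ← Measure.map_map measurable_reprSym (measurable_sub_const x₀), (measurePreserving_sub_right volume x₀).map_eq,
      map_reprSym_volume]
    have h2 : ((volume : Measure V3).restrict (symCube (Fin 3))).map (fun y => ε⁻¹ • y) =
        ((volume : Measure V3).map (fun y => ε⁻¹ • y)).restrict (ε⁻¹ • symCube (Fin 3)) := by
      rw [hs.restrict_map, ← Set.image_smul, hs.injective.preimage_image]
    rw [h2, Measure.map_addHaar_smul volume (inv_ne_zero hε.ne'), Measure.restrict_smul, finrank_euclideanSpace_fin,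
      inv_pow, inv_inv, abs_of_pos (pow_pos hε 3)]
  rw [h1, ← Measure.map_prod_map _ _ hg measurable_id, Measure.map_id, hpos, Measure.prod_smul_left]

end Summit.AtomisticToContinuum.HydrodynamicLimit.Theorems.KiferCompactification

end
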